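import Summits.ResolutionOfSingularities.ResolutionOfSingularities.Theorems.WeightedInvariantWeightedThesisHypersurfaceModelProjection
import HarnessLib

/-!
# `EquisingularLift.HypersurfacesSuffice` (crux stmt-ResolutionOfSingularities-15964), line
# `generic-projection-closure`, stub S4: the projection onto its scheme-theoretic image is
# finite birational

For an integral scheme `X` and a finite morphism `φ₀ : X → ℙ^{d+1}_k` whose stalk map at the
generic point is surjective, the scheme-theoretic image `H = φ₀.image ⊆ ℙ^{d+1}_k` is integral and
the induced morphism `φ₀.toImage : X → H` is finite and birational. This is the last block of the
tree's `HypersurfaceModel.hypersurfaceModel_of_projection`, re-concluded for the CLOSED image in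
`ℙ^{d+1}` itself (no puncturing at the vertex is needed for this part).
[Hartshorne 1977, I Prop. 4.9; Kollár 2007, proof of Prop. 2.48; Stacks 0AB1]
-/

noncomputable section

set_option linter.dupNamespace false -- mandated namespace of this single-conjunct summit

open CategoryTheory CategoryTheory.Limits AlgebraicGeometry TopologicalSpace
open Literature.AlgebraicGeometry.Resolution Literature.AlgebraicGeometry.Motives
open Literature.AlgebraicGeometry.Motives.Segre (toSpec)
open Summit.ResolutionOfSingularities.ResolutionOfSingularities.Theorems.WeightedThesis

namespace Summit.ResolutionOfSingularities.ResolutionOfSingularities.Theorems.HypersurfacesSuffice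

/-- **S4 — the projection onto its scheme-theoretic image is finite birational.** Let `X` be an
integral scheme and `φ₀ : X → ℙ^{d+1}_k` a finite morphism whose stalk map
`𝒪_{ℙ^{d+1}, φ₀(η)} → K(X)` at the generic point `η` is surjective. Then the scheme-theoretic
image `H = φ₀.image` is integral (`ChowLemmaProof.isIntegral_image`: `φ₀` is quasi-compact),
`φ₀.toImage : X → H` is finite (`φ₀.toImage ≫ φ₀.imageι = φ₀` is finite and `φ₀.imageι` is
separated) and birational (`HypersurfaceModel.isBirational_of_surjective_stalkMap`: `φ₀.toImage` is
dominant, `H → ℙ^{d+1} → Spec k` is locally of finite type as `ℙ^{d+1} → Spec k` is proper, and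
the stalk map of `φ₀.toImage` at `η` is surjective, being the second factor of that of `φ₀`).
[folklore; cite: StacksProject, Tag 0AB1] -/
theorem stub_toImage_finite_birational : ∀ (d : ℕ) (k : Type) [Field k] (X : AlgebraicGeometry.Scheme.{0}) [AlgebraicGeometry.IsIntegral X] (φ₀ : X ⟶ Literature.AlgebraicGeometry.Morphisms.ProjCech.PP k (d + 1)) [AlgebraicGeometry.IsFinite φ₀], Function.Surjective (φ₀.stalkMap (genericPoint X)) → AlgebraicGeometry.IsIntegral φ₀.image ∧ AlgebraicGeometry.IsFinite φ₀.toImage ∧ Literature.AlgebraicGeometry.Resolution.IsBirational φ₀.toImage := by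
  -- adapted from the last block of `HypersurfaceModel.hypersurfaceModel_of_projection`
  intro d k _ X _ φ₀ _ hgen
  haveI : IsIntegral φ₀.image := ChowLemmaProof.isIntegral_image φ₀
  haveI : IsFinite (φ₀.toImage ≫ φ₀.imageι) := by rw [φ₀.toImage_imageι]; infer_instance
  haveI : IsFinite φ₀.toImage := IsFinite.of_comp φ₀.toImage φ₀.imageι
  refine ⟨inferInstance, inferInstance, ?_⟩
  -- `H → ℙ^{d+1} → Spec k` is locally of finite type (`ℙ^{d+1} → Spec k` is proper)
  obtain ⟨-, -, hpr⟩ := HypersurfaceModel.smooth_isSeparated_isProper_toSpec k (d + 1)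
  haveI := hpr
  -- the stalk map of `φ₀.toImage` at `η` is the second factor of that of `φ₀`
  have h2 : Function.Surjective ((φ₀.toImage ≫ φ₀.imageι).stalkMap (genericPoint X)) := by
    rw [φ₀.toImage_imageι]; exact hgen
  rw [Scheme.Hom.stalkMap_comp] at h2
  exact HypersurfaceModel.isBirational_of_surjective_stalkMap φ₀.toImage
    (φ₀.imageι ≫ toSpec (Fin (d + 1 + 1)) k) (Function.Surjective.of_comp h2)

end Summit.ResolutionOfSingularities.ResolutionOfSingularities.Theorems.HypersurfacesSuffice
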